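import Summits.ABC.IUTFork.Thm311RealFull
import Summits.ABC.IUTFork.Cor312VolumesRealAssembly
import Literature.IUT.LogVolume.TensorPacketMeasureValues
import HarnessLib

/-!
# [IUTchIII] Theorem 3.11 (i)(c) — the degree clause AS FROZEN is satisfiable at the real Dupuy–Hilado-volume
# instantiation (Sierpiński regions); hence the typed Theorem 3.11 holds there for a suitable region binder

Proof-only file (D-0012; no definitions) of the abc-iut cell (seat abc-iut-w4-d087, gen 2; SUPPORT piece for the
node IUTchIII:Thm3.11(i), holder of record abc-iut-c312-1); TAKES NO SIDE on [IUTchIII] Cor. 3.12.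

CONTEXT. abc-iut-c312-1's `Thm311RealFull` (gen 4) shows that at the real instantiation the typed Theorem 3.11
(`FullSituation.Statement`) is EQUIVALENT to its clause (i)(c) `Situation.DegreeClause` = [IUTchIII] Prop. 3.9 (iii)
p. 117 for the BINDERS `Adm`, `logvol`, `region` ("the global log-volume … is equal to the degree of the arithmetic line
bundle determined by `J`"), and fails for `logvol := 0`. abc-iut-c312-5's `Real.situationDHVol` (`Cor312VolumesRealAssembly`)
binds `Adm`/`logvol` to the CONCRETE verbatim container `Real.summandPiecesDH` (at `v_ℚ = p`: direct product regions
over the summands `v⃗` of the real prime packets `F_{v_0} ⊗_{ℚ_p} ⋯ ⊗_{ℚ_p} F_{v_j}` with abc-iut-c312-3's `PacketAdm`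
(= positive finite Haar measure, Dupuy–Hilado Def. 3.5.1) and normalised log-measure `packetLogμ` (Def. 3.6.1, §3.4),
weights `weightDH = 1/[F:ℚ]^{j+1}`; at `v_ℚ = ∞`: the trivial container), leaving `region` free; the objects of (c)
are c312-3's `FinDivisor F` — `ℝ`-COEFFICIENT divisors on the finite places — with `deg := FinDivisor.deg F`.

WHAT THIS FILE PROVES (bookkeeping over landed theorems; fully-qualified closing types):

* `Real.exists_adm_logvol_eq_inr` — at a prime `p`, for every label `j` and EVERY REAL `t` there is an
  admissible region of the `(j+1)`-packet of weighted log-volume exactly `t`: the preimage under the comparison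
  of a product `Π_{v⃗} A_{v⃗}` of admissible subsets of the summands of prescribed normalised log-measure
  (`Literature.IUT.LogVolume.exists_packetAdm_packetLogμ_eq`, Sierpiński's intermediate-value theorem for the
  finely divisible Haar measure of `⊕_j L_j`); `Real.exists_adm_logvol_eq_inl` — at `∞` the whole packet is
  admissible of log-volume `0`;
* `Real.degreeClause_DHVol_of_localVolumes` — ANY region binder whose regions are admissible with log-volume
  `Σ_{v | v_ℚ, v ∈ supp J} J(v)·log N(v)` at each `v_ℚ` satisfies the degree clause of `situationDHVol` (finite
  support; `deg J = Σ_{v_ℚ} Σ_{v | v_ℚ} J(v)·log N(v)`, c312-3's `FinDivisor.deg_apply`);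
* `Real.exists_region_degreeClause_DHVol` — **hence `∃ region, (situationDHVol X hlog F … region).DegreeClause`**;
* `Real.exists_region_full_statement_DHVol` — **the typed Theorem 3.11 `FullSituation.Statement` HOLDS at the
  assembled real Dupuy–Hilado-volume instantiation for a suitable region binder**, given only the two (ii)-inputs
  of `Thm311RealFull` (`hlaw`, `harch`) — by c312-1's `Real.full_statement_of_degreeClause`;
  `Real.exists_region_full_statement_DHVol_analytic` — at the analytic logarithms with `archPk := shellPk`
  (abc-iut-w4-d001's `Real.harch_iff_archPk_eq_univ`: this is the whole archimedean packet) NO hypothesis is left.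

HONEST FRAMING / READING NOTE (neutral; ADJUDICATION-SPEC §3 (b)). (1) The regions exhibited at `p` are
MEASURE-THEORETIC (Sierpiński sets of prescribed Haar measure), NOT the ideal boxes `Π_v J_v` of Prop. 3.9 (iii):
for the typed objects (`ℝ`-divisors = the REALIFIED Frobenioid, coefficients such as `ord_v(q_v)/2l` of c312-3's
`PilotData.qPilot`) no box region `x·(R_I)^∼` has the required volume at a non-integral coefficient, and with the
frozen weights even integral coefficients mismatch by the factor recorded in abc-iut-c312-1 gen 5's finding
F-c312-1-g5-1 (`weightDH` × DH-normalised `log μ̄`); the print-faithful discharge with ideal regions over the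
REPAIRED container (Pr-weights, integer divisors, normalised degree) is c312-1's `Thm311RealDegree` — a different
theorem. (2) So what this file measures is exactly: the typed clause (i)(c) constrains `(logvol, region)` only
through "there exist admissible regions of prescribed total volume", which GENUINE Haar volumes satisfy at the frozen
container; cf. abc-iut-L6-t24's `Thm311DegreeClauseScale` (with `1/[F:ℚ]`-normalised volumes and ideal regions the
typed clause would force `[F:ℚ] = 1`). Sources read on the page (render `paper:url-4b091feeb646`): p. 117 l. 40–42
(Prop. 3.9 (iii)), p. 154 l. 46–47 (Thm. 3.11 (i)(c)), p. 95 l. 20–31 (Rmk. 3.1.1 (iii) direct product regions).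
[claim: Mochizuki2012, status: disputed] [cite: DupuyHilado2025, Def. 3.5.1, Def. 3.6.1] [cite: Sierpinski1922Fonctions, Théorème p. 240]
Deliberately NOT here: any definition (the region binder is existential), any change to c312-1's / c312-5's files,
the repaired container, any judgement. typed ≠ proved; instantiated ≠ endorsed.
-/

noncomputable section

open Set Function NumberField IsDedekindDomain CategoryTheory

namespace Summit.ABC.IUTFork.Thm311

namespace Real

open Cor312 Cor312Vol Literature.IUT.LogThetaLattice Literature.IUT.LogVolume

variable {F : Type} [Field F] [NumberField F] (X : PilotData F) {logv : PadicLogs F} (hlog : LogvAnalytic logv)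

/-! ## 1. Admissible regions of prescribed log-volume, place by place -/

/-- **At a prime `p`: an admissible region of the `(j+1)`-packet of ANY prescribed weighted log-volume `t`.** The
region is the preimage under c312-5's comparison `𝓘^ℚ(^{S^±_{j+1}};𝒟^⊢_p) → Π_{v⃗} F_{v_0} ⊗_{ℚ_p} ⋯ ⊗ F_{v_j}` of a
product of admissible subsets of the summands, each of normalised log-measure `t/(#{v⃗}·w)`, `w = 1/[F:ℚ]^{j+1}`
(Sierpiński regions: `Literature.IUT.LogVolume.exists_packetAdm_packetLogμ_eq`); its log-volume is
`Σ_{v⃗} w·log μ̄_{v⃗} = t` (c312-5 `SummandPieces.logvol_preimage_pi`). [cite: DupuyHilado2025, Def. 3.6.1] -/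
theorem exists_adm_logvol_eq_inr (pp : Nat.Primes) (j : (thetaIndex X).Label) (t : ℝ) :
    ∃ A : Set ((logShellsDH X logv).Packet j (.inr pp)),
      (summandPiecesDH X hlog).Adm j (.inr pp) A ∧ (summandPiecesDH X hlog).logvol j (.inr pp) A = t := by
  classical
  haveI : Fact (pp : ℕ).Prime := ⟨pp.2⟩
  set V := summandPiecesDH X hlog with hV
  -- the weight and the number of summands
  have hw : ∀ e : V.E j (.inr pp), V.w j (.inr pp) e = weightDH X j := fun _ => rfl
  have hwpos : 0 < weightDH X j := by
    unfold weightDH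
    have h : (0 : ℝ) < Module.finrank ℚ F := by exact_mod_cast Module.finrank_pos
    positivity
  haveI : Nonempty (V.E j (.inr pp)) := by
    show Nonempty ((thetaIndex X).Caps j → (thetaIndex X).Fibre (.inr pp))
    infer_instance
  have hNpos : (0 : ℝ) < (Finset.univ : Finset (V.E j (.inr pp))).card := by
    exact_mod_cast Finset.univ_nonempty.card_pos
  -- the prescribed normalised log-measure of every summand factor
  set s : ℝ := t / ((Finset.univ : Finset (V.E j (.inr pp))).card * weightDH X j) with hs
  have key : ∀ e : V.E j (.inr pp), ∃ R : Set (V.X j (.inr pp) e),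
      V.adm j (.inr pp) e R ∧ V.logμ j (.inr pp) e R = s := fun e =>
    exists_packetAdm_packetLogμ_eq (pp : ℕ) ((padicPresentationDH X (pp : ℕ) logv (hlog pp)).kk e) s
  choose R hRadm hRvol using key
  refine ⟨V.e j (.inr pp) ⁻¹' Set.pi univ R, V.adm_preimage_pi j (.inr pp) hRadm, ?_⟩
  rw [V.logvol_preimage_pi j (.inr pp) hRadm]
  simp_rw [hRvol, hw]
  rw [Finset.sum_const, nsmul_eq_mul, hs]
  field_simp

/-- **At `v_ℚ = ∞`: the whole packet is admissible of log-volume `0`** (c312-5's convention at the archimedean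
place: the trivial one-point container, Dupuy–Hilado's "no archimedean term").
[cite: DupuyHilado2025, Def. 3.6.3] -/
theorem exists_adm_logvol_eq_inl (u : Unit) (j : (thetaIndex X).Label) :
    ∃ A : Set ((logShellsDH X logv).Packet j (.inl u)),
      (summandPiecesDH X hlog).Adm j (.inl u) A ∧ (summandPiecesDH X hlog).logvol j (.inl u) A = 0 := by
  set V := summandPiecesDH X hlog with hV
  have hadm : ∀ e : V.E j (.inl u), V.adm j (.inl u) e (Set.univ : Set (V.X j (.inl u) e)) := fun _ =>
    Set.univ_nonempty
  refine ⟨V.e j (.inl u) ⁻¹' Set.pi univ fun _ => Set.univ, V.adm_preimage_pi j (.inl u) hadm, ?_⟩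
  rw [V.logvol_preimage_pi j (.inl u) hadm]
  exact Finset.sum_eq_zero fun e _ => by
    show (0 : ℝ) * 0 = 0
    rw [mul_zero]

/-- **At every `v_ℚ`: an admissible region of log-volume the `v_ℚ`-part `Σ_{v | v_ℚ} J(v)·log N(v)` of the
Arakelov degree of an `ℝ`-divisor `J`** (at `∞` that part is `0`). [cite: DupuyHilado2025, §2.5.4, Def. 3.6.1] -/
theorem exists_adm_logvol_eq_localDegree (j : (thetaIndex X).Label) (vQ : (thetaIndex X).VQ) (J : FinDivisor F) :
    ∃ A : Set ((logShellsDH X logv).Packet j vQ), (summandPiecesDH X hlog).Adm j vQ A ∧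
      (summandPiecesDH X hlog).logvol j vQ A =
        ∑ v ∈ J.support, if Place.under (Sum.inr v : Place F) = vQ then J v * logNorm F v else 0 := by
  rcases vQ with u | pp
  · obtain ⟨A, hA, hvol⟩ := exists_adm_logvol_eq_inl X hlog u j
    refine ⟨A, hA, ?_⟩
    rw [hvol]
    symm
    exact Finset.sum_eq_zero fun v _ =>
      if_neg (show Place.under (Sum.inr v : Place F) ≠ Sum.inl u from Sum.inr_ne_inl)
  · exact exists_adm_logvol_eq_inr X hlog pp j _

/-! ## 2. The degree clause of `situationDHVol` from local volumes -/

section DegreeClause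

variable (archPk : ∀ (j : (thetaIndex X).Label) (vQ : (thetaIndex X).VQ), Set ((logShellsDH X logv).Packet j vQ))
  (archSub : ∀ (j : (thetaIndex X).Label) (v : (thetaIndex X).V),
    Set ((logShellsDH X logv).Packet j ((thetaIndex X).over v)))
  (Ψ : ℤ → ∀ v : (thetaIndex X).V, v ∈ (thetaIndex X).Vbad → Set ((logShellsDH X logv).StarPacket v))
  (act : ℤ → ∀ v : (thetaIndex X).V, v ∈ (thetaIndex X).Vbad →
    (logShellsDH X logv).StarPacket v → Module.End ℚ ((logShellsDH X logv).StarPacket v))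
  (Mmod : ℤ → ∀ j : (thetaIndex X).LabelStar, Set ((logShellsDH X logv).GlobalPacket j.1))

/-- **The `v_ℚ`-parts of the Arakelov degree add up to the degree**: `deĝ(J) = Σᶠ_{v_ℚ} Σ_{v | v_ℚ} J(v)·log N(v)`
(every finite place lies over exactly one prime; c312-3's `FinDivisor.deg_apply`). [cite: DupuyHilado2025, §2.5.4] -/
theorem finsum_localDegree_eq_deg (J : FinDivisor F) :
    ∑ᶠ vQ : (thetaIndex X).VQ, (∑ v ∈ J.support, if Place.under (Sum.inr v : Place F) = vQ then J v * logNorm F v else 0) =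
      FinDivisor.deg F J := by
  classical
  set S : Finset (thetaIndex X).VQ := J.support.image fun v => Place.under (Sum.inr v : Place F) with hS
  have hsupp : (Function.support fun vQ : (thetaIndex X).VQ =>
      ∑ v ∈ J.support, if Place.under (Sum.inr v : Place F) = vQ then J v * logNorm F v else 0) ⊆ (S : Set _) := by
    intro vQ hvQ
    obtain ⟨v, hv, hne⟩ := Finset.exists_ne_zero_of_sum_ne_zero hvQ
    have h : Place.under (Sum.inr v : Place F) = vQ := by
      by_contra hc
      exact hne (if_neg hc)
    exact Finset.mem_coe.2 (Finset.mem_image.2 ⟨v, hv, h⟩)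
  rw [finsum_eq_sum_of_support_subset _ hsupp, Finset.sum_comm, FinDivisor.deg_apply, Finsupp.sum]
  refine Finset.sum_congr rfl fun v hv => ?_
  have h1 : (∑ vQ ∈ S, if Place.under (Sum.inr v : Place F) = vQ then J v * logNorm F v else 0) =
      if Place.under (Sum.inr v : Place F) = Place.under (Sum.inr v : Place F) then J v * logNorm F v else 0 :=
    Finset.sum_eq_single_of_mem _
      (by rw [hS]; exact Finset.mem_image.2 ⟨v, hv, rfl⟩)
      (fun vQ _ hne => if_neg (Ne.symm hne))
  rw [if_pos rfl] at h1
  exact h1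

/-- **The degree clause (i)(c) of `situationDHVol` from LOCAL VOLUMES.** If every region `region n j J v_ℚ` is
admissible for the verbatim container and has log-volume the `v_ℚ`-part of `deĝ(J)`, then c312-1's typed
[IUTchIII] Thm. 3.11 (i)(c) / Prop. 3.9 (iii) `Situation.DegreeClause` holds for `Real.situationDHVol … region`
(global Frobenioids of (c) over `F`, `deg := FinDivisor.deg F`). [claim: Mochizuki2012, status: disputed] -/
theorem degreeClause_DHVol_of_localVolumes
    (region : ℤ → ∀ j : (thetaIndex X).LabelStar, FinDivisor F → ∀ vQ : (thetaIndex X).VQ,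
      Set ((logShellsDH X logv).Packet j.1 vQ))
    (hadm : ∀ n j J vQ, (summandPiecesDH X hlog).Adm j.1 vQ (region n j J vQ))
    (hvol : ∀ n j J vQ, (summandPiecesDH X hlog).logvol j.1 vQ (region n j J vQ) =
      ∑ v ∈ J.support, if Place.under (Sum.inr v : Place F) = vQ then J v * logNorm F v else 0) :
    (situationDHVol X hlog F archPk archSub Ψ act Mmod region).DegreeClause := by
  classical
  rintro n j (J : FinDivisor F)
  change (∀ vQ, (summandPiecesDH X hlog).Adm j.1 vQ (region n j J vQ)) ∧
    {vQ | (summandPiecesDH X hlog).logvol j.1 vQ (region n j J vQ) ≠ 0}.Finite ∧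
      FinDivisor.deg F J = ∑ᶠ vQ, (summandPiecesDH X hlog).logvol j.1 vQ (region n j J vQ)
  refine ⟨fun vQ => hadm n j J vQ, ?_, ?_⟩
  ·
    refine (Finset.finite_toSet (J.support.image fun v => Place.under (Sum.inr v : Place F))).subset ?_
    intro vQ hvQ
    have h : (∑ v ∈ J.support, if Place.under (Sum.inr v : Place F) = vQ then J v * logNorm F v else 0) ≠ 0 := by
      have h' : (summandPiecesDH X hlog).logvol j.1 vQ (region n j J vQ) ≠ 0 := hvQ
      rwa [hvol] at h'
    obtain ⟨v, hv, hne⟩ := Finset.exists_ne_zero_of_sum_ne_zero h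
    have h2 : Place.under (Sum.inr v : Place F) = vQ := by
      by_contra hc
      exact hne (if_neg hc)
    exact Finset.mem_coe.2 (Finset.mem_image.2 ⟨v, hv, h2⟩)
  · simp_rw [hvol]
    exact (finsum_localDegree_eq_deg X J).symm

/-- **[IUTchIII] Thm. 3.11 (i)(c) AS FROZEN IS SATISFIABLE AT THE REAL DUPUY–HILADO-VOLUME INSTANTIATION**: there is a
region binder for which c312-5's `Real.situationDHVol` (verbatim container `summandPiecesDH`: genuine Haar
log-measures on the real prime packets, trivial at `∞`; objects `FinDivisor F`, `deg := FinDivisor.deg F`)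
satisfies `Situation.DegreeClause` — regions = Sierpiński sets of prescribed measure in every summand over `p`
(module docstring, READING NOTE (1)). [claim: Mochizuki2012, status: disputed] -/
theorem exists_region_degreeClause_DHVol :
    ∃ region : ℤ → ∀ j : (thetaIndex X).LabelStar, FinDivisor F → ∀ vQ : (thetaIndex X).VQ,
        Set ((logShellsDH X logv).Packet j.1 vQ),
      Summit.ABC.IUTFork.Thm311.Situation.DegreeClause
        (situationDHVol X hlog F archPk archSub Ψ act Mmod region) := by
  choose A hA using fun (j : (thetaIndex X).Label) (vQ : (thetaIndex X).VQ) (J : FinDivisor F) =>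
    exists_adm_logvol_eq_localDegree X hlog j vQ J
  exact ⟨fun _ j J vQ => A j.1 vQ J,
    degreeClause_DHVol_of_localVolumes X hlog archPk archSub Ψ act Mmod _ (fun _ j J vQ => (hA j.1 vQ J).1)
      fun _ j J vQ => (hA j.1 vQ J).2⟩

end DegreeClause

/-! ## 3. The typed Theorem 3.11 at the real Dupuy–Hilado-volume instantiation -/

section FullStatement

variable (archPk : ∀ (j : (thetaIndex X).Label) (vQ : (thetaIndex X).VQ), Set ((logShellsDH X logv).Packet j vQ))
  (archSub : ∀ (j : (thetaIndex X).Label) (v : (thetaIndex X).V),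
    Set ((logShellsDH X logv).Packet j ((thetaIndex X).over v)))
  (Ψ₀ : ∀ v : Place F, v ∈ (thetaIndex X).Vbad → Set ((logShellsDH X logv).StarPacket v))
  (act₀ : ∀ v : Place F, v ∈ (thetaIndex X).Vbad → (logShellsDH X logv).StarPacket v →
    Module.End ℚ ((logShellsDH X logv).StarPacket v))
  (Mmod₀ : ∀ j : (thetaIndex X).LabelStar, Set ((logShellsDH X logv).GlobalPacket j.1))
  (thetaDiv₀ : ℤ → ℤ → LgpDivisor F (thetaIndex X).lstar)
  {S : StripFrame.{0}} (G : LatticeGlue S) (Λ : LogThetaLatticeDiagram G.logData G.linkData)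
  {Kap : Type} [Category.{0} Kap] (FM : Core S.DHT ⥤ Kap)

/-- **THE TYPED THEOREM 3.11 HOLDS AT THE REAL DUPUY–HILADO-VOLUME INSTANTIATION, for a suitable region binder.**
Full situation as in c312-1's `Real.full_statement_of_degreeClause` with `Aut := stripAutDH`, `Ism := ismDH logv`
(c312-5's `logShellsDH`), `Adm`/`logvol` := the CONCRETE container `summandPiecesDH` at every line, coric LGP line data
(`Ψ₀ := Real.splittingMonoidLGP …`), strictified columns with the honest (Ind3)-images, L6-glued (iii)-objects;
hypotheses: ONLY the two (ii)-inputs `hlaw` (`O_v ⊆ I_v`) and `harch` (`shellPk ⊆ archPk` at `∞`, i.e.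
`archPk ∞ = univ` by abc-iut-w4-d001's `harch_iff_archPk_eq_univ`). Composition of `exists_region_degreeClause_DHVol`
with c312-1's theorem. [claim: Mochizuki2012, status: disputed] -/
theorem exists_region_full_statement_DHVol (hlaw : LogvLaw logv)
    (harch : ∀ (j : (thetaIndex X).Label) (vQ : (thetaIndex X).VQ), ¬ (thetaIndex X).IsNon vQ →
      (((logShellsDH X logv).shellPk j vQ : Set ((logShellsDH X logv).Packet j vQ)) ⊆ archPk j vQ))
    (qroot : ∀ v : HeightOneSpectrum (𝓞 F), Carrier (.inr v : Place F))
    (ζ : ∀ v : HeightOneSpectrum (𝓞 F), (thetaIndex X).LabelStar → (Carrier (.inr v : Place F))ˣ)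
    (hΨ : ∀ (v : HeightOneSpectrum (𝓞 F)) (hv : (.inr v : Place F) ∈ (thetaIndex X).Vbad),
      Ψ₀ (.inr v) hv = splittingMonoidLGP X logv stripAutDH (ismDH logv) refl_mem_stripAutDH
        (refl_mem_ismDH logv) v (qroot v) (ζ v)) :
    ∃ region : ℤ → ∀ j : (thetaIndex X).LabelStar, FinDivisor F → ∀ vQ : (thetaIndex X).VQ,
        Set ((logShellsDH X logv).Packet j.1 vQ),
      Summit.ABC.IUTFork.Thm311.FullSituation.Statement
        ({ LatticeSituation.ofShells (logShellsDH X logv) F archPk archSub (summandPiecesDH X hlog).Adm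
              (summandPiecesDH X hlog).logvol (fun _ => Ψ₀) (fun _ => act₀) (fun _ => Mmod₀) region
              (fun _ _ => (summandPiecesDH X hlog).Adm) (fun _ _ => (summandPiecesDH X hlog).logvol)
              (fun _ _ => Ψ₀) (fun _ _ => Mmod₀)
              (fun _ _ m' j vQ =>
                (logShellsDH X logv).tprodImages j vQ fun v => iterImage logv m' v.1)
              (fun _ _ j vQ => (logShellsDH X logv).tprodImages j vQ fun v => shell logv v.1)
              thetaDiv₀ with
            link := LinkData.ofGlueRadial G Λ FM } : FullSituation (thetaIndex X)) := by
  obtain ⟨region, hdeg⟩ :=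
    exists_region_degreeClause_DHVol X hlog archPk archSub (fun _ => Ψ₀) (fun _ => act₀) (fun _ => Mmod₀)
  exact ⟨region, full_statement_of_degreeClause X logv stripAutDH (ismDH logv) refl_mem_stripAutDH
    (refl_mem_ismDH logv) archPk archSub _ _ Ψ₀ act₀ Mmod₀ region thetaDiv₀ G Λ FM hlaw harch qroot ζ hΨ hdeg⟩

end FullStatement

/-! ## 4. At the analytic logarithms with the archimedean integral structure := the whole packet -/

section Analytic

variable
  (archSub : ∀ (j : (thetaIndex X).Label) (v : (thetaIndex X).V),
    Set ((logShellsDH X (analyticLogv F)).Packet j ((thetaIndex X).over v)))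
  (Ψ₀ : ∀ v : Place F, v ∈ (thetaIndex X).Vbad → Set ((logShellsDH X (analyticLogv F)).StarPacket v))
  (act₀ : ∀ v : Place F, v ∈ (thetaIndex X).Vbad → (logShellsDH X (analyticLogv F)).StarPacket v →
    Module.End ℚ ((logShellsDH X (analyticLogv F)).StarPacket v))
  (Mmod₀ : ∀ j : (thetaIndex X).LabelStar, Set ((logShellsDH X (analyticLogv F)).GlobalPacket j.1))
  (thetaDiv₀ : ℤ → ℤ → LgpDivisor F (thetaIndex X).lstar)
  {S : StripFrame.{0}} (G : LatticeGlue S) (Λ : LogThetaLatticeDiagram G.logData G.linkData)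
  {Kap : Type} [Category.{0} Kap] (FM : Core S.DHT ⥤ Kap)

/-- **THE TYPED THEOREM 3.11 HOLDS at the fully concrete real instantiation, the (ii)-inputs DISCHARGED**: analytic
`p_v`-adic logarithms (c312-5 `Real.analyticLogv`: the law `logvLaw_analyticLogv` discharges `hlaw`, analyticity
`logvAnalytic_analyticLogv` the container), container `summandPiecesDHAnalytic`, archimedean integral structure
`archPk := shellPk` (`harch` by `subset_rfl`; = the whole packet, abc-iut-w4-d001 `coe_shellPk_inl_eq_univ`),
coric line data whose (b)-slot at the bad places is the LGP splitting monoid (the definitional side condition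
`hΨ` on the binder `Ψ₀`, as in c312-1's theorem), ANY remaining data binders — for a suitable (Sierpiński) region
binder. A measurement of the typing (module docstring READING NOTE); no side taken. [claim: Mochizuki2012, status: disputed] -/
theorem exists_region_full_statement_DHVol_analytic
    (qroot : ∀ v : HeightOneSpectrum (𝓞 F), Carrier (.inr v : Place F))
    (ζ : ∀ v : HeightOneSpectrum (𝓞 F), (thetaIndex X).LabelStar → (Carrier (.inr v : Place F))ˣ)
    (hΨ : ∀ (v : HeightOneSpectrum (𝓞 F)) (hv : (.inr v : Place F) ∈ (thetaIndex X).Vbad),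
      Ψ₀ (.inr v) hv = splittingMonoidLGP X (analyticLogv F) stripAutDH (ismDH (analyticLogv F))
        refl_mem_stripAutDH (refl_mem_ismDH (analyticLogv F)) v (qroot v) (ζ v)) :
    ∃ region : ℤ → ∀ j : (thetaIndex X).LabelStar, FinDivisor F → ∀ vQ : (thetaIndex X).VQ,
        Set ((logShellsDH X (analyticLogv F)).Packet j.1 vQ),
      Summit.ABC.IUTFork.Thm311.FullSituation.Statement
        ({ LatticeSituation.ofShells (logShellsDH X (analyticLogv F)) F
              (fun j vQ => ((logShellsDH X (analyticLogv F)).shellPk j vQ :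
                Set ((logShellsDH X (analyticLogv F)).Packet j vQ)))
              archSub (summandPiecesDHAnalytic X).Adm (summandPiecesDHAnalytic X).logvol
              (fun _ => Ψ₀) (fun _ => act₀) (fun _ => Mmod₀) region
              (fun _ _ => (summandPiecesDHAnalytic X).Adm) (fun _ _ => (summandPiecesDHAnalytic X).logvol)
              (fun _ _ => Ψ₀) (fun _ _ => Mmod₀)
              (fun _ _ m' j vQ =>
                (logShellsDH X (analyticLogv F)).tprodImages j vQ fun v => iterImage (analyticLogv F) m' v.1)
              (fun _ _ j vQ =>
                (logShellsDH X (analyticLogv F)).tprodImages j vQ fun v => shell (analyticLogv F) v.1)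
              thetaDiv₀ with
            link := LinkData.ofGlueRadial G Λ FM } : FullSituation (thetaIndex X)) :=
  exists_region_full_statement_DHVol X (logvAnalytic_analyticLogv (F := F))
    (fun j vQ => ((logShellsDH X (analyticLogv F)).shellPk j vQ :
      Set ((logShellsDH X (analyticLogv F)).Packet j vQ)))
    archSub Ψ₀ act₀ Mmod₀ thetaDiv₀ G Λ FM (logvLaw_analyticLogv F) (fun _ _ _ => subset_rfl) qroot ζ hΨ


/-- **THE TYPED THEOREM 3.11 HOLDS at the fully concrete real instantiation with the LGP slot FILLED IN — a theorem
with NO hypothesis**: as `exists_region_full_statement_DHVol_analytic`, the (b)-binder now := the LGP splitting monoid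
`Real.splittingMonoidLGP` at every bad (finite) place (and `∅` at the archimedean places, which are never bad), for
any `2l`-th roots `qroot` and torsion profiles `ζ`; the definitional side condition `hΨ` is `rfl`. What remains
quantified are pure DATA binders (`archSub`, `act₀`, `Mmod₀`, `thetaDiv₀`, the L6 glue `G Λ FM`, `qroot`, `ζ`) and the
existential region binder. A measurement of the typing (module docstring READING NOTE); no side taken.
[claim: Mochizuki2012, status: disputed] -/
theorem exists_region_full_statement_DHVol_analytic_LGP
    (qroot : ∀ v : HeightOneSpectrum (𝓞 F), Carrier (.inr v : Place F))
    (ζ : ∀ v : HeightOneSpectrum (𝓞 F), (thetaIndex X).LabelStar → (Carrier (.inr v : Place F))ˣ) :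
    ∃ region : ℤ → ∀ j : (thetaIndex X).LabelStar, FinDivisor F → ∀ vQ : (thetaIndex X).VQ,
        Set ((logShellsDH X (analyticLogv F)).Packet j.1 vQ),
      Summit.ABC.IUTFork.Thm311.FullSituation.Statement
        ({ LatticeSituation.ofShells (logShellsDH X (analyticLogv F)) F
              (fun j vQ => ((logShellsDH X (analyticLogv F)).shellPk j vQ :
                Set ((logShellsDH X (analyticLogv F)).Packet j vQ)))
              archSub (summandPiecesDHAnalytic X).Adm (summandPiecesDHAnalytic X).logvol
              (fun _ => fun (x : Place F) (_ : x ∈ (thetaIndex X).Vbad) =>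
                match x with
                | .inr v => splittingMonoidLGP X (analyticLogv F) stripAutDH (ismDH (analyticLogv F))
                    refl_mem_stripAutDH (refl_mem_ismDH (analyticLogv F)) v (qroot v) (ζ v)
                | .inl _ => ∅)
              (fun _ => act₀) (fun _ => Mmod₀) region
              (fun _ _ => (summandPiecesDHAnalytic X).Adm) (fun _ _ => (summandPiecesDHAnalytic X).logvol)
              (fun _ _ => fun (x : Place F) (_ : x ∈ (thetaIndex X).Vbad) =>
                match x with
                | .inr v => splittingMonoidLGP X (analyticLogv F) stripAutDH (ismDH (analyticLogv F))
                    refl_mem_stripAutDH (refl_mem_ismDH (analyticLogv F)) v (qroot v) (ζ v)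
                | .inl _ => ∅)
              (fun _ _ => Mmod₀)
              (fun _ _ m' j vQ =>
                (logShellsDH X (analyticLogv F)).tprodImages j vQ fun v => iterImage (analyticLogv F) m' v.1)
              (fun _ _ j vQ =>
                (logShellsDH X (analyticLogv F)).tprodImages j vQ fun v => shell (analyticLogv F) v.1)
              thetaDiv₀ with
            link := LinkData.ofGlueRadial G Λ FM } : FullSituation (thetaIndex X)) :=
  exists_region_full_statement_DHVol_analytic X archSub
    (fun (x : Place F) (_ : x ∈ (thetaIndex X).Vbad) =>
      match x with
      | .inr v => splittingMonoidLGP X (analyticLogv F) stripAutDH (ismDH (analyticLogv F))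
          refl_mem_stripAutDH (refl_mem_ismDH (analyticLogv F)) v (qroot v) (ζ v)
      | .inl _ => ∅)
    act₀ Mmod₀ thetaDiv₀ G Λ FM qroot ζ (fun _ _ => rfl)

end Analytic

end Real

end Summit.ABC.IUTFork.Thm311

end
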